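import Mathlib
import Summits.RiemannHypothesis.RiemannHypothesis.Theorems.SoloInformedGroundStateTracking
import Literature.NumberTheory.LFunctions.RiemannXiProofs
import Literature.NumberTheory.LFunctions.WeilGroundState
import HarnessLib

/-!
# ROUTE R-K «COUNT-AND-THIN»: SC-3 (thin convergence) from `L²`-tracking at ONE exponential rate

Handoff track (ROUTE 1′), prove-1 gen13; companion of `HandoffCountThin*.lean` (idea-3 gen22 ROUTE
R-K) and of Solo's `SoloInformedGroundStateTracking` (Connes 2026 (M2) split into Fact 6.4 + weighted
`L²` tracking). Built imports only.

Solo's `riemannHypothesis_of_L2_tracking` needs the ground states to track the comparison vectors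
`k_n` in the weighted sense `e^{α aₙ} √(2aₙ) ‖cₙ uₙ − kₙ‖₂ → 0` for EVERY `0 < α < 1/2` (the whole
open strip `|Im z| < 1/2` is used by Hurwitz), plus (M1) and the Connes–van Suijlekom fact. The thin
rectangles of ROUTE R-K need the strip only up to `|Im z| ≤ δ` for ONE `δ > 0`:

* `tendstoUniformlyOn_of_tracking` — if `k̂_t(1/2 + iz) → Ξ(z)` uniformly on a set `K` with
  `|Im z| ≤ δ` on `K`, the `u_t ∈ L²` vanish a.e. off `[-a_t, a_t]`, and
  `e^{δ a_t} √(2a_t) ‖c_t u_t − k_t‖₂ → 0` (ONE rate `δ`), then `c_t û_t(1/2 + iz) → Ξ(z)` uniformly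
  on `K` (Cauchy–Schwarz strip bound `norm_weilMellin_le_of_ae_vanish`).

So SC-3 for the ground states follows from Fact 6.4 on thin rectangles (Connes 2026 / CCM Lemma 7.3
give it on closed substrips) and tracking at ANY ONE positive exponential rate — by Temple–Kato
(`groundState_dist_sq_le`) a power saving `λ^{-2δ}/log λ` in «excess energy of k_λ over the bottom
÷ spectral gap» suffices, against `λ^{-1}/log λ` for the full strip. The price is the other conjunct:
given SC-3, SC-2 at `T` is exactly «RH up to `T`» (`HandoffCountThinPinning`). Nothing here is, or
suggests, a proof of RH.
-/

set_option linter.dupNamespace false  -- the mandated namespace repeats `RiemannHypothesis`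

noncomputable section

open Filter Set Topology Metric Complex MeasureTheory
open Literature.NumberTheory.LFunctions

namespace Summit.RiemannHypothesis.RiemannHypothesis.Theorems

namespace CountThin

/-- **THIN from tracking at one rate.** Let `u_t, k_t ∈ L²` vanish a.e. off `[-a_t, a_t]`
(`a_t ≥ 0`), `c_t ∈ ℂ`, and let `K ⊆ ℂ` with `|Im z| ≤ δ` on `K` (`δ ≥ 0`). If
`z ↦ k̂_t(1/2 + iz)` converges to `Ξ` uniformly on `K` and
`e^{δ a_t} √(2 a_t) ‖c_t u_t − k_t‖₂ → 0`, then `z ↦ c_t û_t(1/2 + iz)` converges to `Ξ` uniformly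
on `K`. (For `K` = a thin rectangle `[0, T] × [-δ, δ]` this is SC-3 at `T` for `û_t` with
normalisers `c_t`.) -/
theorem tendstoUniformlyOn_of_tracking (a : ℝ → ℝ) (u k : ℝ → ℝ → ℂ) (c : ℝ → ℂ)
    (ha : ∀ t, 0 ≤ a t) (hu : ∀ t, MemLp (u t) 2)
    (hua : ∀ t, ∀ᵐ x : ℝ, x ∉ Icc (-(a t)) (a t) → u t x = 0)
    (hk : ∀ t, MemLp (k t) 2) (hka : ∀ t, ∀ᵐ x : ℝ, x ∉ Icc (-(a t)) (a t) → k t x = 0)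
    {δ : ℝ} {K : Set ℂ} (hK : ∀ z ∈ K, |z.im| ≤ δ)
    (hkXi : TendstoUniformlyOn (fun t z => weilMellin (k t) (1 / 2 + I * z)) riemannXiUpper atTop K)
    (htrack : Tendsto (fun t => Real.exp (δ * a t) *
      (Real.sqrt (2 * a t) * Real.sqrt (∫ x, ‖c t * u t x - k t x‖ ^ 2))) atTop (𝓝 0)) :
    TendstoUniformlyOn (fun t z => c t * weilMellin (u t) (1 / 2 + I * z)) riemannXiUpper atTop K := by
  rw [Metric.tendstoUniformlyOn_iff] at hkXi ⊢
  intro ε hε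
  have hε2 : 0 < ε / 2 := by positivity
  filter_upwards [hkXi (ε / 2) hε2, htrack.eventually (gt_mem_nhds hε2)] with t hn htr z hz
  set s : ℂ := 1 / 2 + I * z with hs
  -- integrability of both transforms' integrands (L² on a window of finite measure, zero off it)
  have hIu0 : IntegrableOn (u t) (Icc (-(a t)) (a t)) :=
    ((hu t).restrict (Icc (-(a t)) (a t))).integrable one_le_two
  have hIu : Integrable fun x : ℝ => c t * (u t x * cexp ((s - 1 / 2) * x)) :=
    ((hIu0.mul_continuousOn (by fun_prop) isCompact_Icc).integrable_of_ae_notMem_eq_zero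
      ((hua t).mono fun x hx hxs => by simp [hx hxs])).const_mul (c t)
  have hkI : IntegrableOn (k t) (Icc (-(a t)) (a t)) :=
    ((hk t).restrict (Icc (-(a t)) (a t))).integrable one_le_two
  have hIk : Integrable fun x : ℝ => k t x * cexp ((s - 1 / 2) * x) :=
    (hkI.mul_continuousOn (by fun_prop) isCompact_Icc).integrable_of_ae_notMem_eq_zero
      ((hka t).mono fun x hx hxs => by simp [hx hxs])
  -- the difference of transforms is the transform of the difference
  have hdiff : c t * weilMellin (u t) s - weilMellin (k t) s =
      weilMellin (fun x => c t * u t x - k t x) s := by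
    simp only [weilMellin, ← integral_const_mul]
    rw [← integral_sub hIu hIk]
    refine integral_congr_ae (Eventually.of_forall fun x => ?_)
    simp only
    ring
  have hf2 : MemLp (fun x => c t * u t x - k t x) 2 := ((hu t).const_mul (c t)).sub (hk t)
  have hfa : ∀ᵐ x : ℝ, x ∉ Icc (-(a t)) (a t) → c t * u t x - k t x = 0 := by
    filter_upwards [hua t, hka t] with x h1 h2 hxs
    simp [h1 hxs, h2 hxs]
  have hB : ‖c t * weilMellin (u t) s - weilMellin (k t) s‖ ≤
      Real.exp (δ * a t) * (Real.sqrt (2 * a t) *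
        Real.sqrt (∫ x, ‖c t * u t x - k t x‖ ^ 2)) := by
    rw [hdiff, hs]
    refine (norm_weilMellin_le_of_ae_vanish (ha t) hf2 hfa z).trans ?_
    exact mul_le_mul_of_nonneg_right
      (Real.exp_le_exp.2 (mul_le_mul_of_nonneg_right (hK z hz) (ha t))) (by positivity)
  calc dist (riemannXiUpper z) (c t * weilMellin (u t) s)
      ≤ dist (riemannXiUpper z) (weilMellin (k t) s) +
          dist (weilMellin (k t) s) (c t * weilMellin (u t) s) := dist_triangle _ _ _
    _ < ε / 2 + ε / 2 := by
        refine add_lt_add (hn z hz) ?_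
        rw [dist_eq_norm, norm_sub_rev]
        exact hB.trans_lt htr
    _ = ε := add_halves ε

/-- The thin rectangle `[0, T] × [-δ, δ]` satisfies `|Im z| ≤ δ`. -/
theorem abs_im_le_of_mem_thinRect {T δ : ℝ} {z : ℂ} (hz : z ∈ Icc 0 T ×ℂ Icc (-δ) δ) :
    |z.im| ≤ δ :=
  abs_le.mpr (mem_reProdIm.mp hz).2

/-- **SC-3 for the ground states from Fact 6.4 on thin rectangles + tracking at ONE rate.** Windows
`a_t ≥ 0`, ground states `u_t` (`IsWeilGroundState (a t) (u t)`), comparison vectors `k_t ∈ L²` off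
`[-a_t, a_t]` a.e. zero with `k̂_t(1/2 + iz) → Ξ` uniformly on every `[0, T] × [-δ, δ]`, normalisers
`c_t`, and `e^{δ a_t} √(2 a_t) ‖c_t u_t − k_t‖₂ → 0`: then `c_t û_t(1/2 + iz) → Ξ` uniformly on every
`[0, T] × [-δ, δ]` — the thin convergence SC-3 (with the normalisers `c_t`). -/
theorem thinConvergence_of_groundState_tracking (a : ℝ → ℝ) (u k : ℝ → ℝ → ℂ) (c : ℝ → ℂ)
    (hu : ∀ t, IsWeilGroundState (a t) (u t))
    (hk : ∀ t, MemLp (k t) 2) (hka : ∀ t, ∀ᵐ x : ℝ, x ∉ Icc (-(a t)) (a t) → k t x = 0)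
    {δ : ℝ}
    (hkXi : ∀ T : ℝ, 0 < T → TendstoUniformlyOn (fun t z => weilMellin (k t) (1 / 2 + I * z))
      riemannXiUpper atTop (Icc 0 T ×ℂ Icc (-δ) δ))
    (htrack : Tendsto (fun t => Real.exp (δ * a t) *
      (Real.sqrt (2 * a t) * Real.sqrt (∫ x, ‖c t * u t x - k t x‖ ^ 2))) atTop (𝓝 0)) :
    ∀ T : ℝ, 0 < T → TendstoUniformlyOn (fun t z => c t * weilMellin (u t) (1 / 2 + I * z))
      riemannXiUpper atTop (Icc 0 T ×ℂ Icc (-δ) δ) :=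
  fun T hT => tendstoUniformlyOn_of_tracking a u k c (fun t => (hu t).pos.le)
    (fun t => (hu t).memLp) (fun t => (hu t).ae_eq_zero_of_notMem) hk hka
    (fun _ hz => abs_im_le_of_mem_thinRect hz) (hkXi T hT) htrack

/-! Axiom census (expected `propext`, `Classical.choice`, `Quot.sound`). -/
#print axioms thinConvergence_of_groundState_tracking

end CountThin

end Summit.RiemannHypothesis.RiemannHypothesis.Theorems

end
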